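import Summits.Parity.BatemanHorn.Theses.AlmostPrimeZeros
import Summits.Parity.BatemanHorn.Theorems.AlmostPrimeZerosSystemZeroRepulsionNearZone
import Summits.Parity.BatemanHorn.Theorems.AlmostPrimeZerosSystemZeroRepulsionFarZoneWide
import Summits.Parity.BatemanHorn.Theorems.AlmostPrimeZerosSystemZeroRepulsionMajorantOfSmoothRough
import Summits.Parity.BatemanHorn.Theorems.AlmostPrimeZerosSystemZeroRepulsionSmoothPeriodicFactorisation

/-!
# Crux `SystemZeroRepulsion` (stmt-Parity-11291): the conditional reductions, kernel-checked

Route `AlmostPrimeZeros`, crux `Summit.Parity.BatemanHorn.Theses.AlmostPrimeZeros.SystemZeroRepulsion`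
(for every Bateman–Horn system `f`, `T_f(x) := Σ_ρ ‖1 − ρ‖⁻² ≤ C_f` for all `x ≥ 2`, the sum over the
roots, with multiplicity, of the almost-prime polynomial `S_x(z) = Σ_{0 ≤ n ≤ x} z^{s_f(n)}`,
`s_f(n) = Σ_i Σ_{p^v ∥ f_i(n)} min(v, 2)`).  Notation: `L = log log x`.

This file records, as sorry-free theorems concluding the route decl BY NAME, what the crux has been
reduced to by the line `smooth-rough-lattice-acquisition` (three line leads, 2026-08-16):

* `SystemZeroRepulsion_of_discMajorant_of_farMomentWide` — the crux follows from TWO one-sided,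
  positive-centre statements about `S_x` itself, for every Bateman–Horn system:
  (DiscMajorant) `‖S_x(z)‖ ≤ A·x·(log x)^{k(Re z − 1)}·e^{C‖z−1‖^{3/2}}` on the disc `‖z − 1‖ ≤ 3L`,
  `x ≥ x₀(f)` — the LSD-quality majorant carrying the HARMONIC exponent `k(Re z − 1) log log x`, which
  Jensen's formula at the free centre `z = 1` integrates to zero (landed near-zone stub
  `stub_nearZone_of_majorant`, p74536); and
  (FarMomentWide) `Σ_{n ≤ x} t^{s_f(n)} ≤ (x+1)·e^{C(tL + t²/L)}` for `1 ≤ t ≤ √(log x)` — the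
  parity-free exponential moment along `f` that clears the far zone `‖1 − ρ‖ ≥ L` (landed far-zone
  stub `stub_farZone_of_farMomentWide`, p86487).
* `discMajorant_of_discMajorantLog` — the same with the Γ-growth budget `e^{C‖z−1‖ log(‖z−1‖+2)}`
  (the form the LSD heuristic `S_x(z) ≈ x λ_f(z)(log x)^{k(z−1)} Γ(z)^{−k}` predicts) in place of
  `e^{C‖z−1‖^{3/2}}`, by `r log (r+2) ≤ 3 r^{3/2} + 1`; hence
  `SystemZeroRepulsion_of_discMajorantLog_of_farMomentWide`.
* `SystemZeroRepulsion_of_smoothRough` — the line's own net content: the crux follows from its three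
  open registered stubs S1′ `stub_farMomentWide`, S5 `stub_roughEquidistribution`, S6
  `stub_roughMajorant` (statements verbatim), through the landed S4 (smooth periodic factorisation,
  p87125), S7 (resummation, p76635), S3 and S2′.

STATUS OF THE HYPOTHESES (why this is a reduction and not a proof).  Both hypotheses are theorems
for `k = 0` and for `k = 1`, `f` linear (route item `LinearCappedRepulsion`, closed; far moment
p83375), and OPEN for every other Bateman–Horn system: DiscMajorant at `z = −1` contains the
Liouville-type saving `Σ_{n≤x} (−1)^{s_f(n)} ≪ x (log x)^{−2k}` along `f`, which the crux itself
implies (`…EulerSpeciesFactorisation.stub_liouvilleSaving`, p87976) and which is open for nonlinear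
`f` (Chowla along an irreducible polynomial) and for `k ≥ 2` (quantitative two-point Chowla);
FarMomentWide for `Σ deg f_i ≥ 2` needs Poisson-quality large deviations of `ω(f(n))` beyond sieve
level `x`.  Nothing in this file is conditional on them: they are hypotheses of implications.
-/

noncomputable section

namespace Summit.Parity.BatemanHorn.Cruxes.SystemZeroRepulsion.Reduction

open scoped BigOperators Nat
open Summit.Parity.BatemanHorn.Theses.AlmostPrimeZeros
open Summit.Parity.BatemanHorn.Cruxes.SystemZeroRepulsion.SmoothRoughLatticeAcquisition

/-! ### Glue: zone splitting, positivity, `eventually ⇒ every x` -/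

/-- A nonnegative sequence bounded from some point on is bounded everywhere (finitely many earlier
values are absorbed into the constant). -/
theorem bounded_of_eventually_bounded {T : ℕ → ℝ} (hT : ∀ x, 0 ≤ T x) {B : ℝ} {x₀ : ℕ}
    (h : ∀ x, x₀ ≤ x → T x ≤ B) : ∃ C : ℝ, ∀ x, T x ≤ C := by
  -- adapted from the line skeleton Cruxes/SystemZeroRepulsion/Lines/smooth_rough_lattice_acquisition.lean
  refine ⟨B + ∑ x ∈ Finset.range x₀, T x, fun x => ?_⟩
  have hB : 0 ≤ B := (hT x₀).trans (h x₀ le_rfl)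
  have hS : 0 ≤ ∑ x ∈ Finset.range x₀, T x := Finset.sum_nonneg fun x _ => hT x
  by_cases hx : x₀ ≤ x
  · exact (h x hx).trans (le_add_of_nonneg_right hS)
  · have hx' : x ∈ Finset.range x₀ := Finset.mem_range.2 (lt_of_not_ge hx)
    calc T x ≤ ∑ x ∈ Finset.range x₀, T x := Finset.single_le_sum (fun x _ => hT x) hx'
      _ ≤ B + ∑ x ∈ Finset.range x₀, T x := le_add_of_nonneg_left hB

/-- The zero functional of a root multiset splits into the near zone `‖1 − ρ‖ < R` and the far zone
`R ≤ ‖1 − ρ‖`. -/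
theorem zoneSplit (s : Multiset ℂ) (R : ℝ) :
    (s.map (fun ρ : ℂ => (‖(1 : ℂ) - ρ‖ ^ 2)⁻¹)).sum =
      ((s.filter (fun ρ : ℂ => ‖(1 : ℂ) - ρ‖ < R)).map (fun ρ : ℂ => (‖(1 : ℂ) - ρ‖ ^ 2)⁻¹)).sum +
      ((s.filter (fun ρ : ℂ => R ≤ ‖(1 : ℂ) - ρ‖)).map (fun ρ : ℂ => (‖(1 : ℂ) - ρ‖ ^ 2)⁻¹)).sum := by
  conv_lhs => rw [← Multiset.filter_add_not (fun ρ : ℂ => ‖(1 : ℂ) - ρ‖ < R) s]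
  rw [Multiset.map_add, Multiset.sum_add]
  congr 3
  exact Multiset.filter_congr fun ρ _ => not_lt

/-- Each summand `(‖1 − ρ‖²)⁻¹` is nonnegative, hence so is every zone sum. -/
theorem zoneSum_nonneg (s : Multiset ℂ) :
    0 ≤ (s.map (fun ρ : ℂ => (‖(1 : ℂ) - ρ‖ ^ 2)⁻¹)).sum := by
  refine Multiset.sum_nonneg fun t ht => ?_
  obtain ⟨ρ, -, rfl⟩ := Multiset.mem_map.1 ht
  positivity

/-! ### The two-hypothesis reduction -/

/-- **`SystemZeroRepulsion ⟸ DiscMajorant ∧ FarMomentWide`** (kernel-checked; concludes the route decl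
by name).  If every Bateman–Horn system admits (i) the one-sided disc majorant
`‖S_x(z)‖ ≤ A x (log x)^{k(Re z−1)} e^{C‖z−1‖^{3/2}}` on `‖z − 1‖ ≤ 3 log log x` for `x ≥ x₀(f)` and
(ii) the wide exponential moment `Σ_{n≤x} t^{s_f(n)} ≤ (x+1) e^{C(t log log x + t²/log log x)}` for
`x ≥ 3`, `1 ≤ t ≤ √(log x)`, then `T_f(x) = Σ_ρ ‖1−ρ‖⁻²` is bounded for every system.
Proof: `T_f = [near zone ‖1−ρ‖ < log log x] + [far zone]`; (i) bounds the near zone from some `x₁`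
on (`stub_nearZone_of_majorant`: Jensen at the centre `1`, the harmonic exponent integrates to
zero), (ii) bounds the far zone from some `x₂` on (`stub_farZone_of_farMomentWide`: Jensen + wide
dyadic layer-cake); the finitely many earlier `x` are absorbed into the constant. -/
theorem SystemZeroRepulsion_of_discMajorant_of_farMomentWide :
    (∀ (k : ℕ) (f : Fin k → Polynomial ℤ), Literature.NumberTheory.Sieve.IsBatemanHornSystem f →
      ∃ A C : ℝ, ∃ x₀ : ℕ, ∀ x : ℕ, x₀ ≤ x → ∀ z : ℂ, ‖z - 1‖ ≤ 3 * Real.log (Real.log (x : ℝ)) →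
        ‖(∑ n ∈ Finset.range (x + 1), (z : ℂ) ^ (∑ i, (((f i).eval (n : ℤ)).toNat.factorization.sum fun _ v => min v 2)))‖ ≤
          A * (x : ℝ) * (Real.log (x : ℝ)) ^ ((k : ℝ) * ((z : ℂ).re - 1)) * Real.exp (C * ‖(z : ℂ) - 1‖ ^ (3 / 2 : ℝ))) →
    (∀ (k : ℕ) (f : Fin k → Polynomial ℤ), Literature.NumberTheory.Sieve.IsBatemanHornSystem f →
      ∃ C : ℝ, ∀ x : ℕ, 3 ≤ x → ∀ t : ℝ, 1 ≤ t → t ≤ Real.sqrt (Real.log (x : ℝ)) →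
        (∑ n ∈ Finset.range (x + 1), (t : ℝ) ^ (∑ i, (((f i).eval (n : ℤ)).toNat.factorization.sum fun _ v => min v 2))) ≤
          ((x : ℝ) + 1) * Real.exp (C * (t * Real.log (Real.log (x : ℝ)) + t ^ 2 / Real.log (Real.log (x : ℝ))))) →
    Summit.Parity.BatemanHorn.Theses.AlmostPrimeZeros.SystemZeroRepulsion := by
  intro hdisc hfar k f hf
  obtain ⟨C₁, x₁, h₁⟩ := stub_nearZone_of_majorant hdisc k f hf
  obtain ⟨C₂, x₂, h₂⟩ := stub_farZone_of_farMomentWide hfar k f hf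
  have hT0 : ∀ x : ℕ, 0 ≤ (((∑ n ∈ Finset.range (x + 1), (Polynomial.X : Polynomial ℂ) ^
      (∑ i, (((f i).eval (n : ℤ)).toNat.factorization.sum fun _ v => min v 2)))).roots.map
        (fun ρ : ℂ => (‖(1 : ℂ) - ρ‖ ^ 2)⁻¹)).sum := fun x => zoneSum_nonneg _
  obtain ⟨C, hC⟩ := bounded_of_eventually_bounded hT0 (B := C₁ + C₂) (x₀ := max x₁ x₂)
    (fun x hx => by
      rw [zoneSplit _ (Real.log (Real.log (x : ℝ)))]
      exact add_le_add (h₁ x (le_of_max_le_left hx)) (h₂ x (le_of_max_le_right hx)))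
  exact ⟨C, fun x _ => hC x⟩

/-! ### The Γ-growth form of the disc majorant -/

/-- `log (r + 2) ≤ 2 √r + 1` for `r ≥ 0`. -/
private theorem log_add_two_le {r : ℝ} (hr : 0 ≤ r) : Real.log (r + 2) ≤ 2 * Real.sqrt r + 1 := by
  -- adapted from Theorems/AlmostPrimeZerosSystemZeroRepulsionMajorantOfSmoothRough.lean
  have h2 : (0 : ℝ) < r + 2 := by linarith
  have h1 : Real.log (r + 2) = 2 * Real.log (Real.sqrt (r + 2)) := by
    rw [Real.log_sqrt h2.le]; ring
  have h3 : Real.log (Real.sqrt (r + 2)) ≤ Real.sqrt (r + 2) - 1 :=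
    Real.log_le_sub_one_of_pos (Real.sqrt_pos.2 h2)
  have h4 : Real.sqrt (r + 2) ≤ Real.sqrt r + 3 / 2 := by
    rw [Real.sqrt_le_left (by positivity)]
    nlinarith [Real.sq_sqrt hr, Real.sqrt_nonneg r]
  linarith

/-- `r log (r + 2) ≤ 3 r^{3/2} + 1` for `r ≥ 0` (with `r^{3/2}` as the real power). -/
private theorem mul_log_le_rpow {r : ℝ} (hr : 0 ≤ r) :
    r * Real.log (r + 2) ≤ 3 * r ^ (3 / 2 : ℝ) + 1 := by
  have hrp : r ^ (3 / 2 : ℝ) = r * Real.sqrt r := by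
    rw [show (3 / 2 : ℝ) = 1 + 1 / 2 by norm_num, Real.rpow_add' hr (by norm_num), Real.rpow_one,
      Real.sqrt_eq_rpow]
  rw [hrp]
  have h1 : r * Real.log (r + 2) ≤ r * (2 * Real.sqrt r + 1) :=
    mul_le_mul_of_nonneg_left (log_add_two_le hr) hr
  -- `r ≤ r √r + 1`: if `r ≤ 1` trivially, else `√r ≥ 1`
  have h2 : r ≤ r * Real.sqrt r + 1 := by
    rcases le_or_gt r 1 with h | h
    · nlinarith [mul_nonneg hr (Real.sqrt_nonneg r)]
    · have hs : 1 ≤ Real.sqrt r := by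
        rw [show (1 : ℝ) = Real.sqrt 1 by simp]
        exact Real.sqrt_le_sqrt h.le
      nlinarith
  nlinarith [mul_nonneg hr (Real.sqrt_nonneg r)]

/-- **Γ-growth form ⟹ `3/2`-form.**  A disc majorant with the budget `e^{C‖z−1‖ log(‖z−1‖+2)}` (the
growth `e^{O(R log R)}` of `Γ(z)^{−k}` on `‖z‖ ≍ R`, which the LSD heuristic predicts for `S_x`) implies
the disc majorant with budget `e^{C'‖z−1‖^{3/2}}` consumed by the near-zone stub, with
`A' = max A 0 · e^{C⁺}`, `C' = 3C⁺`, `C⁺ = max C 0`, from the same `x₀` on (made `≥ 2` so that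
`log x > 0`). -/
theorem discMajorant_of_discMajorantLog :
    (∀ (k : ℕ) (f : Fin k → Polynomial ℤ), Literature.NumberTheory.Sieve.IsBatemanHornSystem f →
      ∃ A C : ℝ, ∃ x₀ : ℕ, ∀ x : ℕ, x₀ ≤ x → ∀ z : ℂ, ‖z - 1‖ ≤ 3 * Real.log (Real.log (x : ℝ)) →
        ‖(∑ n ∈ Finset.range (x + 1), (z : ℂ) ^ (∑ i, (((f i).eval (n : ℤ)).toNat.factorization.sum fun _ v => min v 2)))‖ ≤
          A * (x : ℝ) * (Real.log (x : ℝ)) ^ ((k : ℝ) * ((z : ℂ).re - 1)) *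
            Real.exp (C * ‖(z : ℂ) - 1‖ * Real.log (‖(z : ℂ) - 1‖ + 2))) →
    ∀ (k : ℕ) (f : Fin k → Polynomial ℤ), Literature.NumberTheory.Sieve.IsBatemanHornSystem f →
      ∃ A C : ℝ, ∃ x₀ : ℕ, ∀ x : ℕ, x₀ ≤ x → ∀ z : ℂ, ‖z - 1‖ ≤ 3 * Real.log (Real.log (x : ℝ)) →
        ‖(∑ n ∈ Finset.range (x + 1), (z : ℂ) ^ (∑ i, (((f i).eval (n : ℤ)).toNat.factorization.sum fun _ v => min v 2)))‖ ≤
          A * (x : ℝ) * (Real.log (x : ℝ)) ^ ((k : ℝ) * ((z : ℂ).re - 1)) * Real.exp (C * ‖(z : ℂ) - 1‖ ^ (3 / 2 : ℝ)) := by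
  intro hlog k f hf
  obtain ⟨A, C, x₀, h⟩ := hlog k f hf
  refine ⟨max A 0 * Real.exp (max C 0), 3 * max C 0, max x₀ 2, fun x hx z hz => ?_⟩
  have hx₀ : x₀ ≤ x := le_of_max_le_left hx
  have hx2 : (2 : ℝ) ≤ x := by exact_mod_cast le_of_max_le_right hx
  have hlogx : 0 < Real.log (x : ℝ) := Real.log_pos (by linarith)
  set r : ℝ := ‖(z : ℂ) - 1‖ with hr
  have hr0 : 0 ≤ r := norm_nonneg _
  set P : ℝ := (x : ℝ) * (Real.log (x : ℝ)) ^ ((k : ℝ) * ((z : ℂ).re - 1)) with hP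
  have hP0 : 0 ≤ P := mul_nonneg (by positivity) (Real.rpow_nonneg hlogx.le _)
  -- the exponent comparison `C r log (r+2) ≤ C⁺ + 3 C⁺ r^{3/2}`
  have hrl : 0 ≤ r * Real.log (r + 2) := mul_nonneg hr0 (Real.log_nonneg (by linarith))
  have hexp : C * r * Real.log (r + 2) ≤ max C 0 + 3 * max C 0 * r ^ (3 / 2 : ℝ) := by
    have h1 : C * r * Real.log (r + 2) ≤ max C 0 * (r * Real.log (r + 2)) := by
      rw [mul_assoc]; exact mul_le_mul_of_nonneg_right (le_max_left C 0) hrl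
    have h2 : max C 0 * (r * Real.log (r + 2)) ≤ max C 0 * (3 * r ^ (3 / 2 : ℝ) + 1) :=
      mul_le_mul_of_nonneg_left (mul_log_le_rpow hr0) (le_max_right C 0)
    nlinarith
  calc ‖(∑ n ∈ Finset.range (x + 1), (z : ℂ) ^ (∑ i, (((f i).eval (n : ℤ)).toNat.factorization.sum fun _ v => min v 2)))‖
      ≤ A * (x : ℝ) * (Real.log (x : ℝ)) ^ ((k : ℝ) * ((z : ℂ).re - 1)) *
          Real.exp (C * ‖(z : ℂ) - 1‖ * Real.log (‖(z : ℂ) - 1‖ + 2)) := h x hx₀ z hz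
    _ = A * (P * Real.exp (C * r * Real.log (r + 2))) := by rw [hP, hr]; ring
    _ ≤ max A 0 * (P * Real.exp (C * r * Real.log (r + 2))) :=
        mul_le_mul_of_nonneg_right (le_max_left A 0) (by positivity)
    _ ≤ max A 0 * (P * Real.exp (max C 0 + 3 * max C 0 * r ^ (3 / 2 : ℝ))) :=
        mul_le_mul_of_nonneg_left (mul_le_mul_of_nonneg_left (Real.exp_le_exp.2 hexp) hP0)
          (le_max_right A 0)
    _ = max A 0 * Real.exp (max C 0) * (x : ℝ) * (Real.log (x : ℝ)) ^ ((k : ℝ) * ((z : ℂ).re - 1)) *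
          Real.exp (3 * max C 0 * ‖(z : ℂ) - 1‖ ^ (3 / 2 : ℝ)) := by
        rw [Real.exp_add, hP, hr]; ring

/-- **`SystemZeroRepulsion ⟸ DiscMajorant (Γ-growth form) ∧ FarMomentWide`**: the two-hypothesis
reduction with the disc majorant asked in the form the LSD heuristic predicts,
`‖S_x(z)‖ ≤ A x (log x)^{k(Re z−1)} e^{C‖z−1‖ log(‖z−1‖+2)}` on `‖z − 1‖ ≤ 3 log log x`. -/
theorem SystemZeroRepulsion_of_discMajorantLog_of_farMomentWide :
    (∀ (k : ℕ) (f : Fin k → Polynomial ℤ), Literature.NumberTheory.Sieve.IsBatemanHornSystem f →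
      ∃ A C : ℝ, ∃ x₀ : ℕ, ∀ x : ℕ, x₀ ≤ x → ∀ z : ℂ, ‖z - 1‖ ≤ 3 * Real.log (Real.log (x : ℝ)) →
        ‖(∑ n ∈ Finset.range (x + 1), (z : ℂ) ^ (∑ i, (((f i).eval (n : ℤ)).toNat.factorization.sum fun _ v => min v 2)))‖ ≤
          A * (x : ℝ) * (Real.log (x : ℝ)) ^ ((k : ℝ) * ((z : ℂ).re - 1)) *
            Real.exp (C * ‖(z : ℂ) - 1‖ * Real.log (‖(z : ℂ) - 1‖ + 2))) →
    (∀ (k : ℕ) (f : Fin k → Polynomial ℤ), Literature.NumberTheory.Sieve.IsBatemanHornSystem f →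
      ∃ C : ℝ, ∀ x : ℕ, 3 ≤ x → ∀ t : ℝ, 1 ≤ t → t ≤ Real.sqrt (Real.log (x : ℝ)) →
        (∑ n ∈ Finset.range (x + 1), (t : ℝ) ^ (∑ i, (((f i).eval (n : ℤ)).toNat.factorization.sum fun _ v => min v 2))) ≤
          ((x : ℝ) + 1) * Real.exp (C * (t * Real.log (Real.log (x : ℝ)) + t ^ 2 / Real.log (Real.log (x : ℝ))))) →
    Summit.Parity.BatemanHorn.Theses.AlmostPrimeZeros.SystemZeroRepulsion :=
  fun hlog hfar =>
    SystemZeroRepulsion_of_discMajorant_of_farMomentWide (discMajorant_of_discMajorantLog hlog) hfar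

/-! ### The line's net content: crux ⟸ S1′ ∧ S5 ∧ S6 -/

/-- **`SystemZeroRepulsion ⟸ S1′ ∧ S5 ∧ S6`** — the net logical content of the line
`smooth-rough-lattice-acquisition`, kernel-checked: the three OPEN registered stubs of the line
(S1′ `stub_farMomentWide`: wide exponential moment along `f`; S5 `stub_roughEquidistribution`: the
rough statistic `s♯_x` (prime factors `> log log x` of the `f_i(n)`, capped at 2) does not see residue
classes to moduli `d ∣ ∏_{p ≤ log log x} p²`, with a power-of-log saving; S6 `stub_roughMajorant`: the
one-sided Γ-growth majorant of the rough sum `Σ_{m₀≤n≤x} z^{s♯_x(n)}` with the sharp exponent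
`U^{k(Re z−1)}`, `U = log x/log log log x`) imply the crux, through the LANDED S4 (exact CRT
factorisation of the smooth weights with Euler-product bounds, p87125), S7 (resummation, p76635),
S3 (near zone, p74536) and S2′ (far zone, p86487).  Hypotheses are the registered signatures verbatim. -/
theorem SystemZeroRepulsion_of_smoothRough :
    (∀ (k : ℕ) (f : Fin k → Polynomial ℤ), Literature.NumberTheory.Sieve.IsBatemanHornSystem f →
      ∃ C : ℝ, ∀ x : ℕ, 3 ≤ x → ∀ t : ℝ, 1 ≤ t → t ≤ Real.sqrt (Real.log (x : ℝ)) →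
        (∑ n ∈ Finset.range (x + 1), (t : ℝ) ^ (∑ i, (((f i).eval (n : ℤ)).toNat.factorization.sum fun _ v => min v 2))) ≤
          ((x : ℝ) + 1) * Real.exp (C * (t * Real.log (Real.log (x : ℝ)) + t ^ 2 / Real.log (Real.log (x : ℝ))))) →
    (∀ (k : ℕ) (f : Fin k → Polynomial ℤ), Literature.NumberTheory.Sieve.IsBatemanHornSystem f →
      ∀ m₀ : ℕ, ∃ δ : ℝ, 0 < δ ∧ ∃ C : ℝ, ∃ x₀ : ℕ, ∀ x : ℕ, x₀ ≤ x → ∀ z : ℂ, ‖z - 1‖ ≤ 3 * Real.log (Real.log (x : ℝ)) →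
        ∀ d a : ℕ, 0 < d → d ∣ (∏ p ∈ Nat.primesLE ⌊Real.log (Real.log (x : ℝ))⌋₊, p ^ 2) →
          ‖(∑ n ∈ (Finset.Ico m₀ (x + 1)).filter (fun n : ℕ => n ≡ a [MOD d]), (z : ℂ) ^ (∑ i, (((f i).eval (n : ℤ)).toNat.factorization.sum fun p v => if Real.log (Real.log (x : ℝ)) < (p : ℝ) then min v 2 else 0))) -
              (∑ n ∈ Finset.Ico m₀ (x + 1), (z : ℂ) ^ (∑ i, (((f i).eval (n : ℤ)).toNat.factorization.sum fun p v => if Real.log (Real.log (x : ℝ)) < (p : ℝ) then min v 2 else 0))) / (d : ℂ)‖ ≤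
            (x : ℝ) / (d : ℝ) * (Real.log (x : ℝ) / Real.log (Real.log (Real.log (x : ℝ)))) ^ ((k : ℝ) * (z.re - 1)) * Real.exp (C * ‖(z : ℂ) - 1‖ * Real.log (‖(z : ℂ) - 1‖ + 2)) *
              (Real.log (x : ℝ)) ^ (-δ)) →
    (∀ (k : ℕ) (f : Fin k → Polynomial ℤ), Literature.NumberTheory.Sieve.IsBatemanHornSystem f →
      ∀ m₀ : ℕ, ∃ A C : ℝ, ∃ x₀ : ℕ, ∀ x : ℕ, x₀ ≤ x → ∀ z : ℂ, ‖z - 1‖ ≤ 3 * Real.log (Real.log (x : ℝ)) →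
        ‖(∑ n ∈ Finset.Ico m₀ (x + 1), (z : ℂ) ^ (∑ i, (((f i).eval (n : ℤ)).toNat.factorization.sum fun p v => if Real.log (Real.log (x : ℝ)) < (p : ℝ) then min v 2 else 0)))‖ ≤
          A * (x : ℝ) * (Real.log (x : ℝ) / Real.log (Real.log (Real.log (x : ℝ)))) ^ ((k : ℝ) * (z.re - 1)) * Real.exp (C * ‖(z : ℂ) - 1‖ * Real.log (‖(z : ℂ) - 1‖ + 2))) →
    Summit.Parity.BatemanHorn.Theses.AlmostPrimeZeros.SystemZeroRepulsion :=
  fun hS1 hS5 hS6 =>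
    SystemZeroRepulsion_of_discMajorant_of_farMomentWide
      (stub_majorant_of_smooth_rough stub_smoothPeriodicFactorisation hS5 hS6) hS1

end Summit.Parity.BatemanHorn.Cruxes.SystemZeroRepulsion.Reduction

end
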